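import Summits.Ventures.HodgeRepro2.T5WeightOrthogonality
import Summits.Ventures.HodgeRepro2.T5IsotypicDecomposition

/-!
# Weight spaces and weight multiplicities: `dim V_χ = ∫ χ_π · conj χ dμ`

Blind cell `pub-hodge-repro2`, seat p1 (gen 12), Tier-5 kernel support for the S4.7 row «the weights of
SO(2) are exactly {3, 5, 7, …}, each once» (P2′) in its general form: the multiplicity of a character
`χ` of a compact abelian group `K` in a continuous finite-dimensional representation `π` — the dimension
of the **weight space** `V_χ = {v | ∀ k, π k v = χ k • v}` — is `∫ χ_π · conj χ dμ`.

* `charRep χ` — the one-dimensional representation `k ↦ χ k • 1` on `ℂ` attached to a continuous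
  unimodular character `χ : K →* ℂˣ`; `character_charRep`, `isUnitary_charRep`, `continuous_charRep`,
  `isIrreducible_toRep_charRep`;
* `weightSpace π χ` — the weight space; `mem_weightSpace`, `isStable_weightSpace`;
* `isCopyOf_charRep_iff` — a subspace is a copy of `charRep χ` iff it is a stable line of weight `χ`;
* **`isotypic_charRep_eq_weightSpace`** — the `charRep χ`-isotypic component IS the weight space;
* **`finrank_weightSpace_eq_integral`** — `dim V_χ = ∫ χ_π · conj χ dμ`;
* `weightSpace_eq_bot_iff` — `V_χ = 0 ⟺ ∫ χ_π · conj χ dμ = 0`.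

Honest scope (unchanged): compact abelian groups, finite-dimensional continuous representations; the
weights {3, 5, 7, …} of the infinite-dimensional π₃⁺ are not an instance ([C]).
-/

namespace Summit.Ventures.HodgeRepro2.T5WeightSpaces

open MeasureTheory T5SchurOrthogonality T5CompleteReducibility T5RestrictionRep T5SchurMathlib
  T5AbelianWeights T5WeightOrthogonality T5IsotypicCopies T5IsotypicDecomposition

variable {K : Type*} [Group K]

section charRep

variable (χ : K →* ℂˣ)

/-- The one-dimensional representation `k ↦ χ k • 1` on `ℂ`. -/
noncomputable def charRep : K →* (ℂ →L[ℂ] ℂ) where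
  toFun k := ((χ k : ℂˣ) : ℂ) • (1 : ℂ →L[ℂ] ℂ)
  map_one' := by simp
  map_mul' k k' := by
    ext
    simp [smul_apply, mul_comm]

/-- `charRep χ k x = χ k * x`. -/
theorem charRep_apply (k : K) (x : ℂ) : charRep χ k x = ((χ k : ℂˣ) : ℂ) * x := by
  simp [charRep]

/-- The character of `charRep χ` is `χ`. -/
theorem character_charRep (k : K) : character (charRep χ) k = ((χ k : ℂˣ) : ℂ) := by
  unfold character
  have h : ((charRep χ k : ℂ →L[ℂ] ℂ) : ℂ →ₗ[ℂ] ℂ) = ((χ k : ℂˣ) : ℂ) • LinearMap.id := by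
    ext
    simp [charRep_apply]
  rw [h, map_smul, LinearMap.trace_id, Module.finrank_self]
  simp

/-- A unimodular character gives a unitary one-dimensional representation. -/
theorem isUnitary_charRep (hχ : ∀ k, ‖((χ k : ℂˣ) : ℂ)‖ = 1) : IsUnitary (charRep χ) := by
  intro k a b
  rw [charRep_apply, charRep_apply]
  simp only [RCLike.inner_apply, map_mul]
  have h : (starRingEnd ℂ) ((χ k : ℂˣ) : ℂ) * ((χ k : ℂˣ) : ℂ) = 1 := by
    rw [Complex.conj_mul', hχ k]
    simp
  linear_combination (b * (starRingEnd ℂ) a) * h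

/-- `charRep χ` is continuous when `χ` is. -/
theorem continuous_charRep [TopologicalSpace K] (hχ : Continuous fun k => ((χ k : ℂˣ) : ℂ)) :
    Continuous (charRep χ) := by
  have : (⇑(charRep χ) : K → ℂ →L[ℂ] ℂ) = fun k => ((χ k : ℂˣ) : ℂ) • (1 : ℂ →L[ℂ] ℂ) := rfl
  rw [this]
  exact hχ.smul continuous_const

/-- `charRep χ` is irreducible (one-dimensional). -/
theorem isIrreducible_charRep : IsIrreducible (charRep χ) :=
  (isIrreducibleSubspace_top_iff (charRep χ)).mp
    (isIrreducibleSubspace_of_finrank_eq_one (charRep χ) (isStable_top _)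
      (by rw [finrank_top, Module.finrank_self]))

/-- `toRep (charRep χ)` is irreducible in Mathlib's sense. -/
instance isIrreducible_toRep_charRep : (toRep (charRep χ)).IsIrreducible :=
  (isIrreducible_iff _).mp (isIrreducible_charRep χ)

end charRep

section weightSpace

variable {V : Type*} [NormedAddCommGroup V] [InnerProductSpace ℂ V]
variable (π : K →* V →L[ℂ] V) (χ : K →* ℂˣ)

/-- The **weight space** of `χ`: the simultaneous eigenvectors `π k v = χ k • v`. -/
def weightSpace : Submodule ℂ V where
  carrier := {v | ∀ k, π k v = ((χ k : ℂˣ) : ℂ) • v}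
  zero_mem' := fun k => by simp
  add_mem' := fun {a b} ha hb k => by rw [map_add, ha k, hb k, smul_add]
  smul_mem' := fun c v hv k => by rw [map_smul, hv k, smul_comm]

/-- Membership in the weight space. -/
theorem mem_weightSpace {v : V} : v ∈ weightSpace π χ ↔ ∀ k, π k v = ((χ k : ℂˣ) : ℂ) • v :=
  Iff.rfl

/-- For a commutative group the weight space is stable. -/
theorem isStable_weightSpace [IsMulCommutative K] : IsStable π (weightSpace π χ) := by
  intro k v hv
  rw [mem_weightSpace] at hv ⊢
  intro k'
  have hc : k' * k = k * k' := IsMulCommutative.is_comm.comm k' k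
  rw [← mul_apply_eq_comp, ← map_mul, hc, map_mul, mul_apply_eq_comp, hv k', map_smul]

/-- A stable line of weight `χ` (spanned by `w ≠ 0` with `π k w = χ k • w`) is a copy of
`charRep χ`: the linear equivalence `ℂ ≃ W`, `c ↦ c • w`, intertwines. -/
theorem isCopyOf_charRep_of_line [FiniteDimensional ℂ V] {W : Submodule ℂ V} (hW : IsStable π W)
    (h1 : Module.finrank ℂ W = 1) {w : V} (hw : w ∈ W) (hw0 : w ≠ 0)
    (hχw : ∀ k, π k w = ((χ k : ℂˣ) : ℂ) • w) : IsCopyOf π (charRep χ) W := by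
  refine ⟨isIrreducibleSubspace_of_finrank_eq_one π hW h1, ⟨?_⟩⟩
  have hne : (⟨w, hw⟩ : W) ≠ 0 := fun h => hw0 (congrArg Subtype.val h)
  have hspan : (ℂ ∙ (⟨w, hw⟩ : W)) = ⊤ := by
    rw [Submodule.eq_top_iff']
    intro x
    obtain ⟨c, hc⟩ := exists_eq_smul h1 hw hw0 x
    exact Submodule.mem_span_singleton.mpr ⟨c, hc.symm⟩
  let e : ℂ ≃ₗ[ℂ] W :=
    (LinearEquiv.toSpanNonzeroSingleton ℂ W (⟨w, hw⟩ : W) hne).trans (LinearEquiv.ofTop _ hspan)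
  have he : ∀ c : ℂ, e c = c • (⟨w, hw⟩ : W) := fun c => by
    simp [e, LinearEquiv.toSpanNonzeroSingleton_apply]
  refine Representation.Equiv.mk e fun k => ?_
  apply LinearMap.ext
  intro c
  apply Subtype.ext
  simp only [LinearMap.comp_apply, LinearEquiv.coe_coe, toRep_apply, he, charRep_apply,
    coe_restrictRep_apply, Submodule.coe_smul, map_smul, hχw k, smul_smul, mul_comm]

/-- A copy of `charRep χ` is a stable line of weight `χ`: its dimension is `1` and the image `w` of
`1 ∈ ℂ` spans it with `π k w = χ k • w`. -/
theorem line_of_isCopyOf_charRep [FiniteDimensional ℂ V] {W : Submodule ℂ V}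
    (hW : IsCopyOf π (charRep χ) W) :
    Module.finrank ℂ W = 1 ∧ ∃ w ∈ W, w ≠ 0 ∧ ∀ k, π k w = ((χ k : ℂˣ) : ℂ) • w := by
  obtain ⟨hirr, ⟨e⟩⟩ := hW
  refine ⟨?_, (e 1 : V), (e 1).2, ?_, ?_⟩
  · rw [← e.toLinearEquiv.finrank_eq, Module.finrank_self]
  · intro h
    have h' : e 1 = 0 := Subtype.ext h
    exact one_ne_zero (e.toLinearEquiv.map_eq_zero_iff.mp h')
  · intro k
    have h1 := Representation.IntertwiningMap.isIntertwining _ _ e.toIntertwiningMap k 1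
    rw [toRep_apply, toRep_apply, charRep_apply, mul_one] at h1
    have h2 : e ((χ k : ℂˣ) : ℂ) = ((χ k : ℂˣ) : ℂ) • e 1 := by
      rw [← map_smul, smul_eq_mul, mul_one]
    have h3 : ((e ((χ k : ℂˣ) : ℂ) : W) : V) = π k ((e 1 : W) : V) := by
      have := congrArg Subtype.val h1
      rw [coe_restrictRep_apply] at this
      exact this
    rw [← h3, h2]
    rfl

/-- **The `charRep χ`-isotypic component is the weight space of `χ`.** -/
theorem isotypic_charRep_eq_weightSpace [FiniteDimensional ℂ V] :
    isotypic π (charRep χ) = weightSpace π χ := by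
  apply le_antisymm
  · refine iSup_le fun W => ?_
    obtain ⟨h1, w, hw, hw0, hχw⟩ := line_of_isCopyOf_charRep π χ W.2
    intro x hx
    obtain ⟨c, hc⟩ := exists_eq_smul h1 hw hw0 ⟨x, hx⟩
    have hx' : x = c • w := congrArg Subtype.val hc
    rw [mem_weightSpace, hx']
    intro k
    rw [map_smul, hχw k, smul_comm]
  · intro v hv
    by_cases hv0 : v = 0
    · rw [hv0]; exact Submodule.zero_mem _
    · rw [mem_weightSpace] at hv
      have hstable : IsStable π (ℂ ∙ v) := by
        intro k x hx
        obtain ⟨c, rfl⟩ := Submodule.mem_span_singleton.mp hx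
        rw [map_smul, hv k, smul_smul]
        exact Submodule.mem_span_singleton.mpr ⟨_, rfl⟩
      have hcopy : IsCopyOf π (charRep χ) (ℂ ∙ v) :=
        isCopyOf_charRep_of_line π χ hstable (finrank_span_singleton hv0)
          (Submodule.mem_span_singleton_self v) hv0 hv
      exact le_isotypic_of_isCopyOf π (charRep χ) hcopy (Submodule.mem_span_singleton_self v)

end weightSpace

section multiplicity

variable [TopologicalSpace K] [IsTopologicalGroup K] [MeasurableSpace K] [BorelSpace K]
  [CompactSpace K]
variable {V : Type*} [NormedAddCommGroup V] [InnerProductSpace ℂ V] [FiniteDimensional ℂ V]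
variable (μ : Measure K) [IsProbabilityMeasure μ] [μ.IsMulLeftInvariant]
variable (π : K →* V →L[ℂ] V) (χ : K →* ℂˣ)

/-- **Weight multiplicities from the character**: `dim V_χ = ∫ χ_π · conj χ dμ` for a continuous
finite-dimensional representation `π` of a compact group and a continuous unimodular character `χ`
(commutativity of `K` is not needed for the formula itself). -/
theorem finrank_weightSpace_eq_integral (hπ : Continuous π)
    (hχc : Continuous fun k => ((χ k : ℂˣ) : ℂ)) (hχ : ∀ k, ‖((χ k : ℂˣ) : ℂ)‖ = 1) :
    (Module.finrank ℂ (weightSpace π χ) : ℂ) =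
      ∫ k, character π k * (starRingEnd ℂ) ((χ k : ℂˣ) : ℂ) ∂μ := by
  rw [← isotypic_charRep_eq_weightSpace,
    finrank_isotypic_eq_integral_mul π μ (charRep χ) hπ (continuous_charRep χ hχc)
      (isUnitary_charRep χ hχ), Module.finrank_self]
  simp only [character_charRep, Nat.cast_one, mul_one]

/-- `V_χ = 0 ⟺ ∫ χ_π · conj χ dμ = 0`. -/
theorem weightSpace_eq_bot_iff (hπ : Continuous π)
    (hχc : Continuous fun k => ((χ k : ℂˣ) : ℂ)) (hχ : ∀ k, ‖((χ k : ℂˣ) : ℂ)‖ = 1) :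
    weightSpace π χ = ⊥ ↔ ∫ k, character π k * (starRingEnd ℂ) ((χ k : ℂˣ) : ℂ) ∂μ = 0 := by
  rw [← finrank_weightSpace_eq_integral μ π χ hπ hχc hχ, Submodule.finrank_eq_zero.symm]
  exact_mod_cast Iff.rfl

end multiplicity

end Summit.Ventures.HodgeRepro2.T5WeightSpaces
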